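import Literature.AlgebraicGeometry.Markman2025.ProductWeilTypeDiscriminant
import Literature.AlgebraicGeometry.Markman2025.WeilHermitianFormSignature

/-!
# Markman 2025 — the split model `V = H¹(X) ⊕ H¹(X)^*` ((1.2.1)–(1.2.2), (2.4.3)–(2.4.6)) and the Gram display
# «`H((0, yᵢ), (0, yⱼ)) = d√−d Θ(yᵢ, yⱼ)`» of the proof of LEMMA 3.1.3 (v2 p. 24 L3–35), kernel-checked for the
# Hermitian form (3.1.2) read as the pair (real part, coefficient of `√−d`)

E. Markman: [M] *Cycles on abelian 2n-folds of Weil type from secant sheaves on abelian n-folds*,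
arXiv:2502.03415 **v2**, bib `Markman2025SecantWeil` — UNREFEREED PREPRINT. «v2 p. N L m» = PyMuPDF line `m` of PDF
page `N` of the public arXiv PDF (sha256/16 `8155aa33870069b8`); read BY EYE at seat lit-w-markman g16 (pub-hsemireg
LIT-W, 2026-08-24) on the 160-dpi renders `r_mar25v2_p03_121_122.png` (`a6ccea323a8ca417`), `r_mar25v2_p14_223_224.png`
(`df6301f9985bb650`), `r_mar25v2_p19_241_242_g16.png` (`1b37965d8bffd818`), `r_mar25v2_p19_footnote8.png`
(`12191ec707bc393c`), `r_mar25v2_p20_243.png` (`c005d6d4ade717d1`), `r_mar25v2_p21_244_246_g16.png`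
(`8e2b540080526316`), `r_mar25v2_p23_lemma313.png` (`d2ce1f37a2d267f5`), `r_mar25v2_p24_lemma313_proof.png`
(`50515cbd8206f024`) in `HOME/lit/Markman-renders-litw-markman-g16/`.

## What is printed (verbatim, by eye)

* (1.2.1)–(1.2.2), v2 p. 3 L49–56: «Let `X` be a projective abelian `n`-fold and set `X̂ := Pic⁰(X)`. Set (1.2.1)
  `V := H¹(X, ℤ) ⊕ H¹(X̂, ℤ)`. Then `V` is endowed with the symmetric non-degenerate unimodular bilinear pairing (1.2.2)
  `((w₁, θ₁), (w₂, θ₂))_V := θ₁(w₂) + θ₂(w₁)`, where we used the natural isomorphism to identify `H¹(X̂, ℤ)` with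
  `H¹(X, ℤ)^*`.»  (p. 15 L29–30: «since `H¹(X, ℤ)` and `H¹(X̂, ℤ)` are isotropic subspaces».)
* (2.2.4), v2 p. 14 L29–34: «Given `λ ∈ K^×`, let `η_λ : V_K → V_K` act on `W₁` by multiplication by `λ` and on `W₂` by
  multiplication by `σ(λ)`. Then `η_λ` leaves `V_ℚ` invariant and we get the homomorphism (2.2.4) `η : K^× → GL(V_ℚ)`».
  (2.4.1), v2 p. 19 L12–27: «Set (2.4.1) `f := η_{√−d} : V_ℚ → V_ℚ` … Note that `f` belongs to `Õ(V_ℚ)`,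
  `(f(x), f(y))_V = d(x, y)_V`, and `f² = −d`, by Lemma 2.2.4. Hence `(f(x), y)_V = (1/d)(f²(x), f(y))_V = −(x, f(y))_V`,
  and so `f` is anti-self-dual.»
* (2.4.3), v2 p. 20 L67–72: «Let `Θ ∈ H^{1,1}(X, ℤ)` be an ample class. Let (2.4.3) `θ : H¹(X, ℚ)^* → H¹(X, ℚ)` be
  contraction with `Θ` and denote its `K`-linear extension by `θ : H¹(X, K)^* → H¹(X, K)` … Note that `θ` is an
  isomorphism of rational Hodge structures under the identification of `H¹(X, ℚ)^*` with `H¹(X̂, ℚ)`.»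
* (2.4.4)–(2.4.6), v2 p. 21 L3–44: «Let `d` be a positive integer. Set `K := ℚ[√−d]`. Set `u := √−dΘ`. Cup product with
  `exp(u)` is a linear automorphism of `H^*(X, K)` corresponding to the spin representation image of an element `exp(u)`
  of `Spin(V_K)` which acts on `V_K` by (2.4.4) `exp(u) · (w, y) = (w − √−dθ(y), y)`, `w ∈ H¹(X, K)` and
  `y ∈ H¹(X̂, K) ≅ H¹(X, K)^*` … Note that `exp(u)` leaves invariant the pure spinor `[pt] ∈ H^{2n}(X, K)` corresponding
  to the maximal isotropic subspace `H¹(X, K)` and leaves invariant every element of the latter subspace. … The maximal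
  isotropic subspaces corresponding to `ℓ₁` and `ℓ₂` are (2.4.6) `W₁ := exp(u)(H¹(X, K)^*) = {(−√−dθ(y), y) : y ∈
  H¹(X, K)^*}`, `W₂ := W̄₁ = {(+√−dθ(y), y) : y ∈ H¹(X, K)^*}`. The intersection `W₁ ∩ W₂` is the zero subspace,
  since `θ` is an isomorphism.»
* (3.1.2), v2 p. 22 L48–52: «Consider the `K`-valued bilinear form on `V_ℚ` given by (3.1.2)
  `H(x, y) := d(x, y)_V + √−d(f(x), y)_V`.»
* LEMMA 3.1.3 (v2 p. 23 L46–48): «Assume that the similarity `f : V_ℚ → V_ℚ` given in Equation (2.4.1) is defined in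
  terms of the oriented plane `P` given in Equation (2.4.5). Then the discriminant of the hermitian form `H` is `(−1)ⁿ`.»
  PROOF (p. 23 L49 – p. 24 L39): «Given a basis `{y₁, …, y_{2n}}` of `H¹(X̂, ℚ)` we get the `K`-basis `{(0, y₁), …,
  (0, y_{2n})}` of `V_ℚ`. We evaluate `det(H((0, yᵢ), (0, yⱼ)))`. Given `y ∈ H¹(X̂, ℚ)`, we get the element
  `exp(u) · (0, y) = (−√−dθ(y), y)` of `W₁`, by Equation (2.4.4). We get `(0, y) = (1/2)[exp(u) · (0, y) +
  \overline{exp(u)} · (0, y)]`, `2f(0, y) = √−d exp(u) · (0, y) + (−√−d)\overline{exp(u)} · (0, y) = √−d(−√−dθ(y), y)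
  − √−d(√−dθ(y), y) = (2dθ(y), 0)`, `H((0, yᵢ), (0, yⱼ)) = d((0, yᵢ), (0, yⱼ))_V + √−d(f(0, yᵢ), (0, yⱼ)) =
  d√−dΘ(yᵢ, yⱼ)`, `det(H(((0, yᵢ), (0, yⱼ))) = (d√−d)^{2n} det(Θ(yᵢ, yⱼ)) = (−1)ⁿd^{3n} det(Θ(yᵢ, yⱼ))`. Now,
  `det(Θ(yᵢ, yⱼ))` is the square of a rational number, since `Θ` is anti-symmetric, and `d^{3n} = Nm((√−d)^{3n})`.
  Hence, `det(H(((0, yᵢ), (0, yⱼ))))Nm(K^×) = (−1)ⁿNm(K^×)`.»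

## What this file proves (kernel-checked algebra of the sentences above; NO named fact, nothing geometric)

MODEL (the «split» coordinates of [M] §2.4). `F` a field (`ℚ`; for the `V_K`-sentences any field containing `s` with
`s² = −d`, read `s = √−d`), `W` («`H¹(X, F)`») and `Y` («`H¹(X̂, F) ≅ H¹(X, F)^*`») two `F`-spaces with the
evaluation `ev : Y →ₗ W →ₗ F` («`θ₁(w₂)`»), `V := W × Y`. The pairing (1.2.2) enters as a HYPOTHESIS `hB : B (w, y)
(w', y') = y(w') + y'(w)` on an arbitrary `B : V → V → F` — it is satisfied by the landed model `EtaSimilarity.pairV` of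
`EtaSimilarityWeilPolarization.lean` (§A/§C there: the split pairing with `pairV_symm`, `pairV_isotropic`, and (2.4.4)
`EtaSimilarity.expU` with `expU_fixes_H1X`, `expU_on_dual`, `expU_neg`, `W1_inter_W2_eq_zero` — NOT re-declared here)
and by any bilinear-map version of it. `θ : Y ≃ₗ[F] W` is (2.4.3) («`θ` is an isomorphism»); `thetaForm ev θ y y' :=
ev y' (θ y)` is the bilinear form written «`Θ(yᵢ, yⱼ)`» on p. 24 (the display `(f(0, yᵢ), (0, yⱼ))_V = dΘ(yᵢ, yⱼ)`
FORCES this reading, see `pairing_f_zero`; its anti-symmetry «since `Θ` is anti-symmetric» is the hypothesis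
`hΘ : ev y' (θ y) = −ev y (θ y')`); `fModel d θ (w, y) := (d·θ(y), −θ⁻¹(w))` is the endomorphism which IS
`f = η_{√−d}` of (2.4.1) on `V_K`: it acts by `s` on `W₁ = {(−sθ(y), y)}` and by `−s` on `W₂ = {(sθ(y), y)}` when
`s² = −d` (`fModel_on_W1/W2`, i.e. (2.2.4) with `λ = √−d`, `σ(λ) = −√−d`; `V_K = W₁ ⊕ W₂` by `half_sum` and the landed
`EtaSimilarity.W1_inter_W2_eq_zero`).
THEOREMS. (2.4.4)/(2.4.6): `expU_preserves_pairing` (`exp(u)·(w, y) = (w − sθ(y), y)` preserves (1.2.2) — printed as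
«an element of `Spin(V_K)`» — given `hΘ`), `isotropic_W1`, `isotropic_W2` («maximal isotropic subspaces `W₁`, `W₂`»,
given `hΘ`); (2.4.1): `fModel_sq` («`f² = −d`»), `fModel_antiSelfDual` («`f` is anti-self-dual», given `hB`, `hΘ`),
`fModel_on_W1`, `fModel_on_W2`; LEMMA 3.1.3's proof: `half_sum` (the `(1/2)[…]` line), `two_f_zero_left` (the
`2f(0, y)` line, its middle expression evaluated componentwise by `ProductDiscriminant.two_f_components` of
`ProductWeilTypeDiscriminant.lean`), `fModel_zero_left` (`f(0, y) = (dθ(y), 0)`), `pairing_dual_dual` («`d((0, yᵢ),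
(0, yⱼ))_V`» vanishes), `pairing_f_zero` (`(f(0, yᵢ), (0, yⱼ))_V = dΘ(yᵢ, yⱼ)`), `H_zero_basis` (THE DISPLAY:
`H((0, yᵢ), (0, yⱼ)) =
d√−dΘ(yᵢ, yⱼ)`, as `⟨0, d·Θ(yᵢ, yⱼ)⟩ = dSqrtNegD d · Θ(yᵢ, yⱼ)` in `K = F(√−d) = QuadraticAlgebra F (−d) 0`, for ANY
`K`-valued `Hf` on `V` whose real part is `d(x, y)_V` and whose `√−d`-coefficient is `(f(x), y)_V` — hypotheses `hre`,
`him`; this is (3.1.2) read as the pair (real part, coefficient of `√−d`), and the model `HermitianForm312.H B'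
(fModel d θ) d` of `WeilHermitianFormSignature.lean`, for a bilinear `B'` with values `B`, satisfies `hre`/`him` by its
`H_re`/`H_im` (`rfl`)), `gram_eq` (the Gram MATRIX on `(0, y i)`,
`i : Fin m`, is `d√−d` times the image of the `Θ`-matrix), `dSqrtNegD_sq`/`dSqrtNegD_pow_two_mul` (`(d√−d)² = −d³`,
`(d√−d)^{2n} = (−1)ⁿd^{3n}`), `det_gram` («`det(H(((0, yᵢ), (0, yⱼ)))) = (−1)ⁿd^{3n} det(Θ(yᵢ, yⱼ))`», the
right-hand side being the image in `K` of that RATIONAL number); and the BRIDGE to LEMMA 3.1.2's file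
`WeilHermitianFormSignature.lean`: the split model satisfies the hypotheses `hf`/`hf2` under which
`HermitianForm312.hermitian_symm`/`linear_right`/`invariant` are proved there (`fModel_antiSelfDual`, `fModel_sq`; `hB`
symmetric is `EtaSimilarity.pairV_symm`), so «`{(0, yᵢ)}` is a `K`-basis and `H` is Hermitian» apply to it verbatim
— section `Bridge312` (APPEND 2026-08-24, once `WeilHermitianFormSignature.lean` was built: this file now imports it)
performs that instantiation for a BILINEAR `B` satisfying `hB`: `pairing_symm`, `H312_re_im` (`hre`/`him` by `rfl`),
`H312_zero_basis` and `H312_det_gram` (the two displays for THE `H` of (3.1.2)), `H312_hermitian_symm` and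
`H312_linear_right` (Lemma 3.1.2's «`H(x, y) = σ(H(y, x))`», «`H(x, η_λ(y)) = λH(x, y)`» DERIVED on the split model
from (1.2.2), (2.4.1) and `hΘ`).
BY VALUE / NOT formalised: `X`, Hodge structures, `Spin(V)`, `exp(u)` as an element of `Spin(V_K)` and its
action on `H^*(X, K)`, the pure spinors `ℓᵢ` and the plane `P` of (2.4.5), Lemma 2.2.4 (that `η(K^×)` is the centralizer),
that `θ` is contraction with an ample class (only «`θ` is an isomorphism» and «`Θ` is anti-symmetric» are used, as
hypotheses), «`det Θ` is the square of a rational number» (a Pfaffian statement; `ProductDiscriminant.discriminant_class`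
takes it by value as `det Θ = q²`) and the discriminant coset in `ℚ^×/Nm(K^×)`. Honest framing (pub-hsemireg): this
re-checks printed linear algebra; it says nothing about the Hodge conjecture and re-proves no theorem of [M].
-/

namespace Literature.AlgebraicGeometry.Markman2025

namespace ThetaGram313

open QuadraticAlgebra

variable {F : Type*} [Field F] {W Y : Type*} [AddCommGroup W] [Module F W] [AddCommGroup Y] [Module F Y]

/-- «`Θ(yᵢ, yⱼ)`» of v2 p. 24 L24–35, read as `yⱼ(θ(yᵢ))` for the contraction `θ` of (2.4.3) (the reading forced by
«`(f(0, yᵢ), (0, yⱼ))_V = dΘ(yᵢ, yⱼ)`», see `pairing_f_zero`). [cite: Markman2025SecantWeil, (2.4.3), v2 p. 20 L67–72; proof of Lemma 3.1.3, p. 24 L24–30] -/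
def thetaForm (ev : Y →ₗ[F] W →ₗ[F] F) (θ : Y ≃ₗ[F] W) (y y' : Y) : F := ev y' (θ y)

/-- Unfolding of `thetaForm`. [cite: Markman2025SecantWeil, proof of Lemma 3.1.3, v2 p. 24 L24–30] -/
@[simp] theorem thetaForm_apply (ev : Y →ₗ[F] W →ₗ[F] F) (θ : Y ≃ₗ[F] W) (y y' : Y) :
    thetaForm ev θ y y' = ev y' (θ y) := rfl

/-- The similarity `f` of (2.4.1) in the split coordinates: `f(w, y) := (d·θ(y), −θ⁻¹(w))` — the unique endomorphism of
`V` acting by `√−d` on `W₁` and by `−√−d` on `W₂` of (2.4.6) (`fModel_on_W1`, `fModel_on_W2`), i.e. `η_{√−d}` of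
(2.2.4). [cite: Markman2025SecantWeil, §2.4 (2.4.1), v2 p. 19 L12–23; §2.2 (2.2.4), p. 14 L29–34; §2.4 (2.4.6), p. 21 L27–44] -/
def fModel (d : F) (θ : Y ≃ₗ[F] W) : (W × Y) →ₗ[F] (W × Y) :=
  (d • ((θ : Y →ₗ[F] W) ∘ₗ LinearMap.snd F W Y)).prod (-((θ.symm : W →ₗ[F] Y) ∘ₗ LinearMap.fst F W Y))

/-- Unfolding of `fModel`. [cite: Markman2025SecantWeil, (2.4.1), v2 p. 19 L12–23] -/
@[simp] theorem fModel_apply (d : F) (θ : Y ≃ₗ[F] W) (w : W) (y : Y) :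
    fModel d θ (w, y) = (d • θ y, -θ.symm w) := rfl

/-- «`d√−d`» as an element of `K = F(√−d) = QuadraticAlgebra F (−d) 0` (`⟨p, q⟩ = p + q√−d`, `√−d = ⟨0, 1⟩`, the
same model of `K` as `HermitianForm312.Kd` in `WeilHermitianFormSignature.lean`).
[cite: Markman2025SecantWeil, proof of Lemma 3.1.3, v2 p. 24 L24–35; §3.1, p. 22 L23–24] -/
def dSqrtNegD (d : F) : QuadraticAlgebra F (-d) 0 := ⟨0, d⟩

section Model

variable (ev : Y →ₗ[F] W →ₗ[F] F) (θ : Y ≃ₗ[F] W) (d s : F) (B : W × Y → W × Y → F)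

/-- `exp(u) · (w, y) = (w − √−dθ(y), y)` ((2.4.4); the landed model is `EtaSimilarity.expU`) preserves the pairing
(1.2.2) — printed: «an element `exp(u)` of `Spin(V_K)` which acts on `V_K` by (2.4.4)» — for `Θ` anti-symmetric.
[cite: Markman2025SecantWeil, §2.4 (2.4.4), v2 p. 21 L7–13; §1.2 (1.2.2), p. 3 L53–56] -/
theorem expU_preserves_pairing (hB : ∀ (w : W) (y : Y) (w' : W) (y' : Y), B (w, y) (w', y') = ev y w' + ev y' w)
    (hΘ : ∀ y y' : Y, ev y' (θ y) = -ev y (θ y')) (w w' : W) (y y' : Y) :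
    B (w - s • θ y, y) (w' - s • θ y', y') = B (w, y) (w', y') := by
  simp only [hB, map_sub, map_smul, smul_eq_mul, hΘ y y']
  ring

/-- «maximal isotropic subspaces `W₁` …» (2.4.6): `((−sθ(y), y), (−sθ(y'), y'))_V = 0`, for `Θ` anti-symmetric.
[cite: Markman2025SecantWeil, §2.4 (2.4.6), v2 p. 21 L27–36; §2.2, p. 14 L21–24] -/
theorem isotropic_W1 (hB : ∀ (w : W) (y : Y) (w' : W) (y' : Y), B (w, y) (w', y') = ev y w' + ev y' w)
    (hΘ : ∀ y y' : Y, ev y' (θ y) = -ev y (θ y')) (y y' : Y) :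
    B (-(s • θ y), y) (-(s • θ y'), y') = 0 := by
  simp only [hB, map_neg, map_smul, smul_eq_mul, hΘ y y']
  ring

/-- «… and `W₂`» (2.4.6): `((sθ(y), y), (sθ(y'), y'))_V = 0`, for `Θ` anti-symmetric.
[cite: Markman2025SecantWeil, §2.4 (2.4.6), v2 p. 21 L37–43; §2.2, p. 14 L21–24] -/
theorem isotropic_W2 (hB : ∀ (w : W) (y : Y) (w' : W) (y' : Y), B (w, y) (w', y') = ev y w' + ev y' w)
    (hΘ : ∀ y y' : Y, ev y' (θ y) = -ev y (θ y')) (y y' : Y) :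
    B (s • θ y, y) (s • θ y', y') = 0 := by
  simp only [hB, map_smul, smul_eq_mul, hΘ y y']
  ring

/-- «`f² = −d`» for the split-coordinate `f`. [cite: Markman2025SecantWeil, (2.4.1), v2 p. 19 L23] -/
theorem fModel_sq (x : W × Y) : fModel d θ (fModel d θ x) = -(d • x) := by
  obtain ⟨w, y⟩ := x
  ext <;> simp

/-- «`(f(x), y)_V = … = −(x, f(y))_V`, and so `f` is anti-self-dual» — for the split-coordinate `f`, the pairing
(1.2.2) and `Θ` anti-symmetric. [cite: Markman2025SecantWeil, (2.4.1), v2 p. 19 L25–27] -/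
theorem fModel_antiSelfDual (hB : ∀ (w : W) (y : Y) (w' : W) (y' : Y), B (w, y) (w', y') = ev y w' + ev y' w)
    (hΘ : ∀ y y' : Y, ev y' (θ y) = -ev y (θ y')) (x x' : W × Y) :
    B (fModel d θ x) x' = -B x (fModel d θ x') := by
  obtain ⟨w, y⟩ := x
  obtain ⟨w', y'⟩ := x'
  have h2 : ev (θ.symm w) w' = -ev (θ.symm w') w := by
    simpa using hΘ (θ.symm w') (θ.symm w)
  simp only [fModel_apply, hB, map_neg, map_smul, LinearMap.neg_apply, smul_eq_mul, hΘ y y', h2]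
  ring

/-- (2.2.4)/(2.4.1) on `W₁`: «`η_λ` … act[s] on `W₁` by multiplication by `λ`», `λ = √−d = s`: `f(−sθ(y), y) =
s·(−sθ(y), y)` when `s² = −d`. [cite: Markman2025SecantWeil, §2.2 (2.2.4), v2 p. 14 L29–34; §2.4 (2.4.1), p. 19 L12–16; §2.4 (2.4.6), p. 21 L27–36] -/
theorem fModel_on_W1 (hs : s * s = -d) (y : Y) : fModel d θ (-(s • θ y), y) = s • ((-(s • θ y), y) : W × Y) := by
  ext <;> simp [smul_smul, hs]

/-- (2.2.4)/(2.4.1) on `W₂`: «… and on `W₂` by multiplication by `σ(λ)`», `σ(√−d) = −√−d`: `f(sθ(y), y) =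
(−s)·(sθ(y), y)` when `s² = −d`. [cite: Markman2025SecantWeil, §2.2 (2.2.4), v2 p. 14 L29–34; §2.4 (2.4.1), p. 19 L12–16; §2.4 (2.4.6), p. 21 L37–43] -/
theorem fModel_on_W2 (hs : s * s = -d) (y : Y) : fModel d θ (s • θ y, y) = (-s) • ((s • θ y, y) : W × Y) := by
  ext <;> simp [smul_smul, hs]

/-- «`(0, y) = (1/2)[exp(u) · (0, y) + \overline{exp(u)} · (0, y)]`» (characteristic `≠ 2`; `exp(u)·(0, y) =
(−sθ(y), y)` is the landed `EtaSimilarity.expU_on_dual`). [cite: Markman2025SecantWeil, proof of Lemma 3.1.3, v2 p. 24 L3–8] -/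
theorem half_sum (h2 : (2 : F) ≠ 0) (y : Y) :
    ((0, y) : W × Y) = (2 : F)⁻¹ • (((-(s • θ y), y) : W × Y) + (s • θ y, y)) := by
  ext
  · simp
  · simp only [Prod.snd_add, Prod.smul_snd]
    rw [← two_smul F y, smul_smul, inv_mul_cancel₀ h2, one_smul]

/-- «`2f(0, y) = √−d exp(u) · (0, y) + (−√−d)\overline{exp(u)} · (0, y) = √−d(−√−dθ(y), y) − √−d(√−dθ(y), y) =
(2dθ(y), 0)`»: the first equality from `fModel_on_W1/W2` and `half_sum`'s decomposition, the last evaluated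
componentwise by `ProductDiscriminant.two_f_components` (file `ProductWeilTypeDiscriminant.lean`).
[cite: Markman2025SecantWeil, proof of Lemma 3.1.3, v2 p. 24 L9–23] -/
theorem two_f_zero_left (hs : s ^ 2 = -d) (y : Y) :
    (2 : F) • fModel d θ (0, y) = s • ((-(s • θ y), y) : W × Y) + (-s) • ((s • θ y, y) : W × Y) ∧
    s • ((-(s • θ y), y) : W × Y) + (-s) • ((s • θ y, y) : W × Y) = ((2 * d) • θ y, 0) := by
  have hW := (ProductDiscriminant.two_f_components d s hs (θ y) (θ y)).1
  have hY := (ProductDiscriminant.two_f_components d s hs (0 : Y) y).2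
  have key : s • ((-(s • θ y), y) : W × Y) + (-s) • ((s • θ y, y) : W × Y) = ((2 * d) • θ y, 0) := by
    ext
    · change s • (-(s • θ y)) + (-s) • (s • θ y) = (2 * d) • θ y
      rw [neg_smul, ← sub_eq_add_neg, hW]
    · change s • y + (-s) • y = 0
      exact hY
  refine ⟨?_, key⟩
  rw [key]
  ext <;> simp [smul_smul]

/-- `f(0, y) = (dθ(y), 0)` (the `2f(0, y)` display divided by `2`; here directly from the split coordinates, in every
characteristic). [cite: Markman2025SecantWeil, proof of Lemma 3.1.3, v2 p. 24 L9–23] -/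
theorem fModel_zero_left (y : Y) : fModel d θ (0, y) = (d • θ y, 0) := by simp

/-- «`d((0, yᵢ), (0, yⱼ))_V`»: the pairing of two vectors of `H¹(X̂)` vanishes («`H¹(X̂, ℤ)` … isotropic»; the landed
model statement is `EtaSimilarity.pairV_isotropic`). [cite: Markman2025SecantWeil, §2.2, v2 p. 15 L29–30; proof of Lemma 3.1.3, p. 24 L24–30] -/
theorem pairing_dual_dual (hB : ∀ (w : W) (y : Y) (w' : W) (y' : Y), B (w, y) (w', y') = ev y w' + ev y' w)
    (y y' : Y) : B (0, y) (0, y') = 0 := by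
  simp [hB]

/-- «`(f(0, yᵢ), (0, yⱼ))`» `= dΘ(yᵢ, yⱼ)` (the coefficient of `√−d` in the display of p. 24 L24–30).
[cite: Markman2025SecantWeil, proof of Lemma 3.1.3, v2 p. 24 L24–30] -/
theorem pairing_f_zero (hB : ∀ (w : W) (y : Y) (w' : W) (y' : Y), B (w, y) (w', y') = ev y w' + ev y' w)
    (y y' : Y) : B (fModel d θ (0, y)) (0, y') = d * thetaForm ev θ y y' := by
  simp [hB]

/-- THE DISPLAY «`H((0, yᵢ), (0, yⱼ)) = d((0, yᵢ), (0, yⱼ))_V + √−d(f(0, yᵢ), (0, yⱼ)) = d√−dΘ(yᵢ, yⱼ)`»: for any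
`K`-valued `Hf` on `V` with real part «`d(x, y)_V`» and `√−d`-coefficient «`(f(x), y)_V`» ((3.1.2) read as the pair
(real part, coefficient of `√−d`) — hypotheses `hre`, `him`), `Hf((0, yᵢ), (0, yⱼ))` has real part `0` and
`√−d`-coefficient `d·Θ(yᵢ, yⱼ)`. [cite: Markman2025SecantWeil, proof of Lemma 3.1.3, v2 p. 24 L24–30; (3.1.2), p. 22 L48–52] -/
theorem H_zero_basis (hB : ∀ (w : W) (y : Y) (w' : W) (y' : Y), B (w, y) (w', y') = ev y w' + ev y' w)
    (Hf : W × Y → W × Y → QuadraticAlgebra F (-d) 0)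
    (hre : ∀ x x', (Hf x x').re = d * B x x') (him : ∀ x x', (Hf x x').im = B (fModel d θ x) x')
    (y y' : Y) : Hf (0, y) (0, y') = ⟨0, d * thetaForm ev θ y y'⟩ := by
  ext
  · rw [hre]; simp [hB]
  · rw [him]; simp [hB]

/-- The same display as a product in `K`: `H((0, yᵢ), (0, yⱼ)) = (d√−d)·Θ(yᵢ, yⱼ)`.
[cite: Markman2025SecantWeil, proof of Lemma 3.1.3, v2 p. 24 L24–30] -/
theorem H_zero_basis' (hB : ∀ (w : W) (y : Y) (w' : W) (y' : Y), B (w, y) (w', y') = ev y w' + ev y' w)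
    (Hf : W × Y → W × Y → QuadraticAlgebra F (-d) 0)
    (hre : ∀ x x', (Hf x x').re = d * B x x') (him : ∀ x x', (Hf x x').im = B (fModel d θ x) x')
    (y y' : Y) : Hf (0, y) (0, y') = dSqrtNegD d * QuadraticAlgebra.C (thetaForm ev θ y y') := by
  rw [H_zero_basis ev θ d B hB Hf hre him]
  ext <;> simp [dSqrtNegD, QuadraticAlgebra.C]

/-- The Gram MATRIX of `H` on the `K`-basis `{(0, y₁), …, (0, y_m)}` is `d√−d` times (the image in `K` of) the matrix
`(Θ(yᵢ, yⱼ))`. [cite: Markman2025SecantWeil, proof of Lemma 3.1.3, v2 p. 23 L49 – p. 24 L30] -/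
theorem gram_eq (hB : ∀ (w : W) (y : Y) (w' : W) (y' : Y), B (w, y) (w', y') = ev y w' + ev y' w)
    (Hf : W × Y → W × Y → QuadraticAlgebra F (-d) 0)
    (hre : ∀ x x', (Hf x x').re = d * B x x') (him : ∀ x x', (Hf x x').im = B (fModel d θ x) x')
    {m : ℕ} (y : Fin m → Y) :
    (Matrix.of fun i j => Hf (0, y i) (0, y j)) =
      dSqrtNegD d • (Matrix.of fun i j => thetaForm ev θ (y i) (y j)).map (algebraMap F (QuadraticAlgebra F (-d) 0)) := by
  ext i j <;> simp [H_zero_basis ev θ d B hB Hf hre him, dSqrtNegD, algebraMap_eq]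

/-- `(d√−d)² = −d³` in `K`. [cite: Markman2025SecantWeil, proof of Lemma 3.1.3, v2 p. 24 L31–35] -/
theorem dSqrtNegD_sq : dSqrtNegD d ^ 2 = QuadraticAlgebra.C (-(d ^ 3)) := by
  ext
  · simp [dSqrtNegD, sq, QuadraticAlgebra.C]; ring
  · simp [dSqrtNegD, sq, QuadraticAlgebra.C]

/-- «`(d√−d)^{2n}` … `= (−1)ⁿd^{3n}`» in `K`. [cite: Markman2025SecantWeil, proof of Lemma 3.1.3, v2 p. 24 L31–35] -/
theorem dSqrtNegD_pow_two_mul (n : ℕ) : dSqrtNegD d ^ (2 * n) = QuadraticAlgebra.C ((-1) ^ n * d ^ (3 * n)) := by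
  rw [pow_mul, dSqrtNegD_sq, ← C_pow, neg_pow, ← pow_mul]

/-- «`det(H(((0, yᵢ), (0, yⱼ)))) = (d√−d)^{2n} det(Θ(yᵢ, yⱼ)) = (−1)ⁿd^{3n} det(Θ(yᵢ, yⱼ))`»: the determinant of the
Gram matrix of `H` on the `K`-basis `{(0, yᵢ)}` (`2n` vectors) is the image in `K` of the element `(−1)ⁿd^{3n} det Θ`
of `F` (= `ℚ`). («`det Θ` is a square» and the coset statement are NOT formalised here — see
`ProductDiscriminant.discriminant_class`, which takes `det Θ = q²` by value.)
[cite: Markman2025SecantWeil, Lemma 3.1.3 (proof), v2 p. 24 L31–39] -/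
theorem det_gram (hB : ∀ (w : W) (y : Y) (w' : W) (y' : Y), B (w, y) (w', y') = ev y w' + ev y' w)
    (Hf : W × Y → W × Y → QuadraticAlgebra F (-d) 0)
    (hre : ∀ x x', (Hf x x').re = d * B x x') (him : ∀ x x', (Hf x x').im = B (fModel d θ x) x')
    (n : ℕ) (y : Fin (2 * n) → Y) :
    (Matrix.of fun i j => Hf (0, y i) (0, y j)).det =
      algebraMap F (QuadraticAlgebra F (-d) 0)
        ((-1) ^ n * d ^ (3 * n) * (Matrix.of fun i j => thetaForm ev θ (y i) (y j)).det) := by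
  rw [gram_eq ev θ d B hB Hf hre him, Matrix.det_smul, Fintype.card_fin, dSqrtNegD_pow_two_mul, map_mul,
    ← RingHom.mapMatrix_apply, ← RingHom.map_det, C_eq_algebraMap]

end Model

/-! ## Bridge to LEMMA 3.1.2's `H` (APPEND, lit-w-markman g19, 2026-08-24): the hypotheses `hre`/`him` of the
`Model` section ARE the real part and the `√−d`-coefficient of THE Hermitian form (3.1.2)
`H(x, y) := d(x, y)_V + √−d(f(x), y)_V` of `WeilHermitianFormSignature.lean` (`HermitianForm312.H`, landed p373612),
taken on the split model with `f = fModel d θ`; so the displays of Lemma 3.1.3's proof hold for that `H` verbatim,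
and that `H` is Hermitian and `K`-linear on the split model (Lemma 3.1.2's «`H(x, y) = σ(H(y, x))` and
`H(x, η_λ(y)) = λH(x, y)`», here DERIVED from (1.2.2), (2.4.1) and `Θ` anti-symmetric rather than assumed).
Nothing new is defined; theorems only. -/

section Bridge312

variable (ev : Y →ₗ[F] W →ₗ[F] F) (θ : Y ≃ₗ[F] W) (d : F) (B : (W × Y) →ₗ[F] (W × Y) →ₗ[F] F)

/-- The pairing (1.2.2) «`((w₁, θ₁), (w₂, θ₂))_V := θ₁(w₂) + θ₂(w₁)`» is symmetric.
[cite: Markman2025SecantWeil, §1.2 (1.2.2), v2 p. 3 L53–56] -/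
theorem pairing_symm (hB : ∀ (w : W) (y : Y) (w' : W) (y' : Y), B (w, y) (w', y') = ev y w' + ev y' w)
    (x x' : W × Y) : B x x' = B x' x := by
  obtain ⟨w, y⟩ := x
  obtain ⟨w', y'⟩ := x'
  rw [hB, hB, add_comm]

/-- (3.1.2) on the split model: the real part of `H((w, y), (w', y'))` is `d((w, y), (w', y'))_V` and its
`√−d`-coefficient is `(f(w, y), (w', y'))_V` — i.e. `HermitianForm312.H B (fModel d θ) d` satisfies the hypotheses
`hre`, `him` of this file's `Model` section, by `rfl`. [cite: Markman2025SecantWeil, (3.1.2), v2 p. 22 L48–52; (2.4.1), p. 19 L12–16] -/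
theorem H312_re_im (x x' : W × Y) :
    (HermitianForm312.H B (fModel d θ) d x x').re = d * B x x' ∧
      (HermitianForm312.H B (fModel d θ) d x x').im = B (fModel d θ x) x' := ⟨rfl, rfl⟩

/-- THE DISPLAY «`H((0, yᵢ), (0, yⱼ)) = d((0, yᵢ), (0, yⱼ))_V + √−d(f(0, yᵢ), (0, yⱼ)) = d√−dΘ(yᵢ, yⱼ)`» for THE
`H` of (3.1.2) (not an arbitrary `Hf`). [cite: Markman2025SecantWeil, proof of Lemma 3.1.3, v2 p. 24 L24–30; (3.1.2), p. 22 L48–52] -/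
theorem H312_zero_basis (hB : ∀ (w : W) (y : Y) (w' : W) (y' : Y), B (w, y) (w', y') = ev y w' + ev y' w)
    (y y' : Y) : HermitianForm312.H B (fModel d θ) d (0, y) (0, y') = dSqrtNegD d * QuadraticAlgebra.C (thetaForm ev θ y y') :=
  H_zero_basis' ev θ d (fun x x' => B x x') hB _ (fun _ _ => rfl) (fun _ _ => rfl) y y'

/-- «`det(H(((0, yᵢ), (0, yⱼ)))) = (d√−d)^{2n} det(Θ(yᵢ, yⱼ)) = (−1)ⁿd^{3n} det(Θ(yᵢ, yⱼ))`» for THE `H` of (3.1.2)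
on the split model. [cite: Markman2025SecantWeil, Lemma 3.1.3 (proof), v2 p. 24 L31–35] -/
theorem H312_det_gram (hB : ∀ (w : W) (y : Y) (w' : W) (y' : Y), B (w, y) (w', y') = ev y w' + ev y' w)
    (n : ℕ) (y : Fin (2 * n) → Y) :
    (Matrix.of fun i j => HermitianForm312.H B (fModel d θ) d (0, y i) (0, y j)).det =
      algebraMap F (QuadraticAlgebra F (-d) 0)
        ((-1) ^ n * d ^ (3 * n) * (Matrix.of fun i j => thetaForm ev θ (y i) (y j)).det) :=
  det_gram ev θ d (fun x x' => B x x') hB _ (fun _ _ => rfl) (fun _ _ => rfl) n y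

/-- LEMMA 3.1.2's «we have `H(x, y) = σ(H(y, x))`» HOLDS on the split model — derived: (1.2.2) is symmetric and the
split `f` of (2.4.1) is anti-self-dual for `Θ` anti-symmetric. [cite: Markman2025SecantWeil, Lemma 3.1.2, v2 p. 23 L4; (2.4.1), p. 19 L25–27] -/
theorem H312_hermitian_symm (hB : ∀ (w : W) (y : Y) (w' : W) (y' : Y), B (w, y) (w', y') = ev y w' + ev y' w)
    (hΘ : ∀ y y' : Y, ev y' (θ y) = -ev y (θ y')) (x x' : W × Y) :
    HermitianForm312.H B (fModel d θ) d x x' = star (HermitianForm312.H B (fModel d θ) d x' x) :=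
  HermitianForm312.hermitian_symm B (fModel d θ) d (pairing_symm ev B hB)
    (fModel_antiSelfDual ev θ d (fun x x' => B x x') hB hΘ) x x'

/-- LEMMA 3.1.2's «`H(x, η_λ(y)) = λH(x, y)`, for `λ ∈ K`» HOLDS on the split model — derived from `f² = −d` for the
split `f` and its anti-self-duality. [cite: Markman2025SecantWeil, Lemma 3.1.2, v2 p. 23 L4–5; (2.4.1), p. 19 L23–27] -/
theorem H312_linear_right (hB : ∀ (w : W) (y : Y) (w' : W) (y' : Y), B (w, y) (w', y') = ev y w' + ev y' w)
    (hΘ : ∀ y y' : Y, ev y' (θ y) = -ev y (θ y')) (c : QuadraticAlgebra F (-d) 0) (x x' : W × Y) :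
    HermitianForm312.H B (fModel d θ) d x (HermitianForm312.eta (fModel d θ) c x') =
      c * HermitianForm312.H B (fModel d θ) d x x' :=
  HermitianForm312.linear_right B (fModel d θ) d (fModel_antiSelfDual ev θ d (fun x x' => B x x') hB hΘ)
    (fModel_sq θ d) c x x'

end Bridge312

end ThetaGram313

end Literature.AlgebraicGeometry.Markman2025
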